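import Summits.BirchSwinnertonDyer.BirchSwinnertonDyer.Theorems.BiquadraticEisensteinDescentHeegnerTwistCouplingInSupplySylvesterCornerCruxOnFamily
import Summits.BirchSwinnertonDyer.BirchSwinnertonDyer.Theorems.BiquadraticEisensteinDescentHeegnerTwistCouplingInSupplySylvesterCornerTable
import Summits.BirchSwinnertonDyer.BirchSwinnertonDyer.Theorems.BiquadraticEisensteinDescentHeegnerTwistCouplingInSupplySylvesterCornerCubicBridge
import HarnessLib

set_option linter.dupNamespace false -- `Summit.BirchSwinnertonDyer.BirchSwinnertonDyer.Theorems.…` (summit = sub, D-0017)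
set_option autoImplicit false

/-!
# Crux `HeegnerTwistCouplingInSupply` (stmt-BirchSwinnertonDyer-21381) — the SYLVESTER `j = 0` corner with the FIXED Heegner field
# `K′ = ℚ(√−2)`: every prime `p ≡ 17, 35 (mod 72)` at which `X³ − 3X − 10` has no root mod `p`, modulo the `3`-descent and Burungale–Tian ONLY

Route `BiquadraticEisensteinDescent` (cell `pub/bsd-wall`; width seat `bsd-wall-cm-bed-w4` g31; THEOREMS ONLY, `--supports`
stmt-BirchSwinnertonDyer-21381, helper). The corner theorems of w4 g26 (`cruxConclusion_of_certificate`: one certificate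
`(K; a, b)` per prime, tables below `10⁵`) and w4 g30 (`FrobeniusFan.cruxOnSylvesterCorner_of_digit`: every digit-non-zero prime
`p ≡ 8 (mod 9)`, modulo the extra class-field-theory hypothesis `hCube`) are complemented here by ONE explicit infinite-type family with
NO class-number input and NO `hCube`:

* `K′ = ℚ(√−2)`: `d_{K′} = −8`, `h(K′) = 1` (kernel value, `SylvesterCorner.exists_field_of_four_mul`), `(−8/3) = +1`; the real field is
  `ℚ(√24) = ℚ(√6)` with the norm-one unit `5 + 2√6 = (10 + 2√24)/2`, i.e. `(a, b) = (10, 2)`, `a² − 24b² = 4`, and cubic `X³ − 3X − 10`.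
* `p ≡ 8 (mod 9)` and `(−8/p) = (−2/p) = +1` (i.e. `p ≡ 1, 3 (mod 8)`) together say `p ≡ 17` or `35 (mod 72)` (§1); then `3 ∤ h(K′) = 1`,
  `h(K′) = 1 < p`, `4 < 8 = |d_{K′}|`, Heegner for `N(W_p)` (prime support `{3, p}`), and — by the CUBIC BRIDGE
  `SylvesterCorner.lucas_of_forall_cubic_ne_zero` (w4 g31) — the Lucas certificate `p ∤ Im((10 + 2√24)^{(p+1)/3})` holds as soon as
  `X³ − 3X − 10` has no root in `𝔽_p`.
* ★★ `cruxConclusion_sqrtMinusTwo` / `cruxOnSylvesterCorner_sqrtMinusTwo` (CLOSED form): for EVERY prime `p ≡ 17, 35 (mod 72)` with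
  `∀ x ∈ 𝔽_p, x³ − 3x − 10 ≠ 0`, the conclusion of crux 21381 at `(W_p, p)` with `K′ = ℚ(√−2)`, MODULO `hDescU` (the unit-form `3`-descent
  hypothesis of `…SylvesterCornerLucasBridge`) and Burungale–Tian ONLY; ★★ `heegnerTwistCouplingInSupply_sylvester_sqrtMinusTwo` (the crux BODY
  verbatim on `W := W_n`); `infinite_corner_of_infinite_noRoot` (the infinite family, the Chebotarev instance as hypothesis `hInf`).
* §4 kernel instances: `p = 17 = 3² + 2·2²` and `p = 107 = 3² + 2·7²` — the two digit-ZERO primes of w4 g30's memo (FROBENIUS-FAN §4), not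
  reached by `cruxOnSylvesterCorner_of_digit` — are certified here (`decide`); at `p = 89 = 9² + 2·2²` the cubic HAS a root (`x = 46`), so
  `ℚ(√−2)` certifies nothing there (`not_lucas_89`; the tables use another menu field).

What is NOT here. For `p = x² + 2y²` in the family one has `3 ∣ x` automatically (§1 `three_dvd_of_sq_add_two_sq`), so `ℚ(√−2)` IS the
Frobenius field of w4 g30's fan (`t = 2x`), and `hCube` predicts: certificate ⟺ `9 ∤ x`. The actual splitting law «`X³ − 3X − 10` has a root
mod `p = x² + 2y²` iff `9 ∣ xy`» is Artin reciprocity for the `S₃`-field `ℚ(√−2, θ)`, `θ³ = 3θ + 10`, over `ℚ(√−2)` (conductor `9`) — not in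
Mathlib, not proved (numerically: all 56 primes of the family below `5000` obey it; 39 of them are certified); the infinitude of the certified
set is a Chebotarev statement (density `2/3` inside the progression) — hypothesis `hInf` only. Nothing here proves the crux (residual C⁺) or BSD.
No definition, no named fact, no `sorry`; axioms standard.
[cite: CohenPazuki2009, §2] [cite: BurungaleTian2026, Thm. 1.1] [cite: IrelandRosen1990, Prop. 5.1.2 and §9.1] [cite: Cox2013, §2.A Thm. 2.13]
-/

noncomputable section

open scoped Classical NumberField

namespace Summit.BirchSwinnertonDyer.BirchSwinnertonDyer.Theorems.SylvesterCorner

open _root_.WeierstrassCurve Literature.NumberTheory.EllipticCurves Literature.NumberTheory.EllipticCurves.Rank1Residual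

/-! ## §1 The progression `p ≡ 17, 35 (mod 72)` -/

section Progression

/-- `p ≡ 17, 35 (mod 72)` iff `p ≡ 8 (mod 9)` and `p ≡ 1, 3 (mod 8)`. [folklore] -/
theorem mod_seventyTwo_iff (p : ℕ) : (p % 72 = 17 ∨ p % 72 = 35) ↔ p % 9 = 8 ∧ (p % 8 = 1 ∨ p % 8 = 3) := by
  omega

/-- `(−8/p) = +1` for `p ≡ 1, 3 (mod 8)` (`(−8/p) = (−2/p)·(4/p)` and the second supplement). [cite: IrelandRosen1990, Prop. 5.1.3] -/
theorem jacobiSym_neg_eight_eq_one {p : ℕ} (hp8 : p % 8 = 1 ∨ p % 8 = 3) : jacobiSym (-8) p = 1 := by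
  have hodd : Odd p := Nat.odd_iff.mpr (by omega)
  have h2 : p % 2 = 1 := by omega
  have hg : (2 : ℤ).gcd p = 1 := by
    rw [Int.gcd_eq_natAbs, Int.natAbs_natCast]
    show Nat.gcd 2 p = 1
    exact Nat.Coprime.gcd_eq_one ((Nat.Prime.coprime_iff_not_dvd Nat.prime_two).mpr (by omega))
  rw [show (-8 : ℤ) = -2 * 2 ^ 2 by norm_num, jacobiSym.mul_left, jacobiSym.sq_one' hg, mul_one, jacobiSym.at_neg_two hodd,
    ZMod.χ₈'_nat_eq_if_mod_eight]
  simp [h2, hp8]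

/-- `(−8/3) = +1`. [folklore] -/
theorem jacobiSym_neg_eight_three : jacobiSym (-8) 3 = 1 := by
  rw [jacobiSym.mod_left, show (-8 : ℤ) % ((3 : ℕ) : ℤ) = 1 by norm_num, jacobiSym.one_left]

/-- For `p ≡ 8 (mod 9)`: `p = x² + 2y²` forces `3 ∣ x` (squares mod `9` are `0, 1, 4, 7`) — so `ℚ(√−2)` is the Frobenius field `t² − 4p = −8y²`,
`t = 2x`, `3 ∣ t`, of the fan of w4 g30. [folklore] -/
theorem three_dvd_of_sq_add_two_sq {p : ℕ} (hp9 : p % 9 = 8) {x y : ℤ} (hxy : (p : ℤ) = x ^ 2 + 2 * y ^ 2) : 3 ∣ x := by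
  have h9 : ((p : ℤ) : ZMod 9) = 8 := by
    have hp' : (p : ℤ) = 9 * ((p / 9 : ℕ) : ℤ) + 8 := by omega
    rw [hp']
    push_cast
    have h90 : (9 : ZMod 9) = 0 := by decide
    rw [h90, zero_mul, zero_add]
  have hx : (x : ZMod 3) = 0 := by
    have key : ∀ a b : ZMod 9, a ^ 2 + 2 * b ^ 2 = 8 → (ZMod.castHom (show 3 ∣ 9 by norm_num) (ZMod 3)) a = 0 := by decide
    have := key (x : ZMod 9) (y : ZMod 9) (by rw [← h9, hxy]; push_cast; ring)
    rwa [map_intCast] at this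
  exact (ZMod.intCast_zmod_eq_zero_iff_dvd x 3).mp hx

end Progression

/-! ## §2 The corner at every certified prime of the progression, `K′ = ℚ(√−2)` -/

section Corner

/-- ★ **The certificate door in CUBIC form** (`exists_cruxConclusion_of_certificate_BT` + the cubic bridge): for a prime `p ≡ 8 (mod 9)`,
a menu row `(D, h; a, b)` — an imaginary quadratic `K` with `d_K = D`, `h_K = h`, `4 < |D|`, `(D/3) = (D/p) = +1`, `h < p`, `3 ∤ h`, `a² + 3Db² = 4` —
and NO root of `X³ − 3X − a` in `𝔽_p`: the conclusion of crux 21381 at `(W_p, p)` with `K′ = K`, MODULO `hDescU` and Burungale–Tian ONLY.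
[cite: CohenPazuki2009, §2] [cite: BurungaleTian2026, Thm. 1.1] [cite: IrelandRosen1990, §9.1] -/
theorem exists_cruxConclusion_of_noRoot_BT
    (hDescU : ∀ (p : ℕ) (K : Type) [Field K] [NumberField K], p.Prime → p % 9 = 8 →
      IsImaginaryQuadratic K → 4 < (NumberField.discr K).natAbs →
      jacobiSym (NumberField.discr K) 3 = 1 → jacobiSym (NumberField.discr K) p = 1 →
      ¬ 3 ∣ NumberField.classNumber K →
      (∀ (L : Type) [Field L] [NumberField L], Module.finrank ℚ L = 2 →
        NumberField.discr L = -3 * NumberField.discr K →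
        ∃ u : (𝓞 L)ˣ, ∀ x : 𝓞 L, (u : 𝓞 L) - x ^ 3 ∉ Ideal.span {(p : 𝓞 L)}) →
      ((⟨0, 0, (p : ℚ), 0, 0⟩ : WeierstrassCurve ℚ).quadraticTwist (NumberField.discr K : ℚ)).mordellWeilRank = 0 ∧
      ∀ c ∈ ((⟨0, 0, (p : ℚ), 0, 0⟩ : WeierstrassCurve ℚ).quadraticTwist (NumberField.discr K : ℚ)).sha,
        3 • c = 0 → c = 0)
    (hBT : burungaleTian_analyticRank_eq_zero_of_selmerCorank_eq_zero_of_hasCM)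
    {p : ℕ} (hp : p.Prime) (hp9 : p % 9 = 8) [(⟨0, 0, (p : ℚ), 0, 0⟩ : WeierstrassCurve ℚ).IsElliptic]
    {D : ℤ} {h : ℕ} (hKex : ∃ (K : Type) (_ : Field K) (_ : NumberField K),
      IsImaginaryQuadratic K ∧ NumberField.discr K = D ∧ NumberField.classNumber K = h)
    (hD4 : 4 < D.natAbs) (hJ3 : jacobiSym D 3 = 1) (hJp : jacobiSym D p = 1) (hh : h < p) (hh3 : ¬ 3 ∣ h)
    {a b : ℤ} (hab : a ^ 2 - (-3 * D) * b ^ 2 = 4) (hnr : ∀ x : ZMod p, x ^ 3 - 3 * x - (a : ZMod p) ≠ 0) :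
    ∃ (K : Type) (_ : Field K) (_ : NumberField K),
      IsImaginaryQuadratic K ∧ 4 < (NumberField.discr K).natAbs ∧
      SatisfiesHeegnerHypothesis ((⟨0, 0, (p : ℚ), 0, 0⟩ : WeierstrassCurve ℚ).conductorNorm ℤ) K ∧
      ((⟨0, 0, (p : ℚ), 0, 0⟩ : WeierstrassCurve ℚ).quadraticTwist (NumberField.discr K : ℚ)).entireLFunction 1 ≠ 0 ∧
      NumberField.classNumber K < p ∧ ¬ p ∣ NumberField.classNumber K := by
  have hp2 : p ≠ 2 := by rintro rfl; omega
  have hp3 : p % 3 = 2 := by omega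
  have hJM : jacobiSym (-3 * D) p = -1 := by
    rw [jacobiSym.mul_left, jacobiSym_neg_three_eq_neg_one (hp.odd_of_ne_two hp2) hp3, hJp]
    norm_num
  exact exists_cruxConclusion_of_certificate_BT (desc_of_descUnit hDescU) hBT hp hp9 hKex hD4 hJ3 hJp hh hh3 rfl hab
    (lucas_of_forall_cubic_ne_zero hp hp2 hp3 hJM hab hnr)

/-- ★★ **The Sylvester corner with `K′ = ℚ(√−2)`.** For a prime `p ≡ 17` or `35 (mod 72)` at which `X³ − 3X − 10` has no root in `𝔽_p`:
MODULO the unit-form `3`-descent hypothesis `hDescU` and Burungale–Tian ONLY — an imaginary quadratic `K′` (`= ℚ(√−2)`, `d_{K′} = −8`,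
`h(K′) = 1`) with `4 < |d_{K′}|`, Heegner for `N(W_p)`, `L(W_p^{(d_{K′})}, 1) ≠ 0`, `h(K′) < p`, `p ∤ h(K′)`: the conclusion of crux 21381 at
`(W_p, p)`. The certificate is `(a, b) = (10, 2)` for the unit `5 + 2√6`; its Lucas form comes from the cubic bridge.
[cite: CohenPazuki2009, §2] [cite: BurungaleTian2026, Thm. 1.1] [cite: IrelandRosen1990, §9.1] [cite: Cox2013, §2.A Thm. 2.13] -/
theorem cruxConclusion_sqrtMinusTwo
    (hDescU : ∀ (p : ℕ) (K : Type) [Field K] [NumberField K], p.Prime → p % 9 = 8 →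
      IsImaginaryQuadratic K → 4 < (NumberField.discr K).natAbs →
      jacobiSym (NumberField.discr K) 3 = 1 → jacobiSym (NumberField.discr K) p = 1 →
      ¬ 3 ∣ NumberField.classNumber K →
      (∀ (L : Type) [Field L] [NumberField L], Module.finrank ℚ L = 2 →
        NumberField.discr L = -3 * NumberField.discr K →
        ∃ u : (𝓞 L)ˣ, ∀ x : 𝓞 L, (u : 𝓞 L) - x ^ 3 ∉ Ideal.span {(p : 𝓞 L)}) →
      ((⟨0, 0, (p : ℚ), 0, 0⟩ : WeierstrassCurve ℚ).quadraticTwist (NumberField.discr K : ℚ)).mordellWeilRank = 0 ∧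
      ∀ c ∈ ((⟨0, 0, (p : ℚ), 0, 0⟩ : WeierstrassCurve ℚ).quadraticTwist (NumberField.discr K : ℚ)).sha,
        3 • c = 0 → c = 0)
    (hBT : burungaleTian_analyticRank_eq_zero_of_selmerCorank_eq_zero_of_hasCM)
    {p : ℕ} (hp : p.Prime) (hp72 : p % 72 = 17 ∨ p % 72 = 35) (hnr : ∀ x : ZMod p, x ^ 3 - 3 * x - 10 ≠ 0)
    [(⟨0, 0, (p : ℚ), 0, 0⟩ : WeierstrassCurve ℚ).IsElliptic] :
    ∃ (K : Type) (_ : Field K) (_ : NumberField K),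
      IsImaginaryQuadratic K ∧ 4 < (NumberField.discr K).natAbs ∧
      SatisfiesHeegnerHypothesis ((⟨0, 0, (p : ℚ), 0, 0⟩ : WeierstrassCurve ℚ).conductorNorm ℤ) K ∧
      ((⟨0, 0, (p : ℚ), 0, 0⟩ : WeierstrassCurve ℚ).quadraticTwist (NumberField.discr K : ℚ)).entireLFunction 1 ≠ 0 ∧
      NumberField.classNumber K < p ∧ ¬ p ∣ NumberField.classNumber K := by
  obtain ⟨hp9, hp8⟩ := (mod_seventyTwo_iff p).mp hp72
  -- the field `ℚ(√−2)`: `d = −8`, `h = 1` (kernel values)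
  have hKex : ∃ (K : Type) (_ : Field K) (_ : NumberField K),
      IsImaginaryQuadratic K ∧ NumberField.discr K = -8 ∧ NumberField.classNumber K = 1 :=
    exists_field_of_four_mul (-2) (by norm_num) 1 (by norm_num) (by norm_num) (by decide +kernel) (by decide +kernel)
  have hnr' : ∀ x : ZMod p, x ^ 3 - 3 * x - ((10 : ℤ) : ZMod p) ≠ 0 := fun x => by push_cast; exact hnr x
  exact exists_cruxConclusion_of_noRoot_BT hDescU hBT hp hp9 hKex (by norm_num) jacobiSym_neg_eight_three
    (jacobiSym_neg_eight_eq_one hp8) hp.one_lt (by norm_num) (a := 10) (b := 2) (by norm_num) hnr'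

/-- ★★ **CLOSED form** (no instance binders: `isElliptic_sylvester` inside): for every prime `p ≡ 17, 35 (mod 72)` at which `X³ − 3X − 10`
has no root mod `p`, the conclusion of `HeegnerTwistCouplingInSupply` at `(W_p, p)` — modulo `hDescU` and Burungale–Tian ONLY.
[cite: CohenPazuki2009, §2] [cite: BurungaleTian2026, Thm. 1.1] [cite: IrelandRosen1990, §9.1] -/
theorem cruxOnSylvesterCorner_sqrtMinusTwo
    (hDescU : ∀ (p : ℕ) (K : Type) [Field K] [NumberField K], p.Prime → p % 9 = 8 →
      IsImaginaryQuadratic K → 4 < (NumberField.discr K).natAbs →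
      jacobiSym (NumberField.discr K) 3 = 1 → jacobiSym (NumberField.discr K) p = 1 →
      ¬ 3 ∣ NumberField.classNumber K →
      (∀ (L : Type) [Field L] [NumberField L], Module.finrank ℚ L = 2 →
        NumberField.discr L = -3 * NumberField.discr K →
        ∃ u : (𝓞 L)ˣ, ∀ x : 𝓞 L, (u : 𝓞 L) - x ^ 3 ∉ Ideal.span {(p : 𝓞 L)}) →
      ((⟨0, 0, (p : ℚ), 0, 0⟩ : WeierstrassCurve ℚ).quadraticTwist (NumberField.discr K : ℚ)).mordellWeilRank = 0 ∧
      ∀ c ∈ ((⟨0, 0, (p : ℚ), 0, 0⟩ : WeierstrassCurve ℚ).quadraticTwist (NumberField.discr K : ℚ)).sha,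
        3 • c = 0 → c = 0)
    (hBT : burungaleTian_analyticRank_eq_zero_of_selmerCorank_eq_zero_of_hasCM) :
    ∀ (p : ℕ) (hp : p.Prime), (p % 72 = 17 ∨ p % 72 = 35) → (∀ x : ZMod p, x ^ 3 - 3 * x - 10 ≠ 0) →
      haveI := isElliptic_sylvester hp.ne_zero
      ∃ (K : Type) (_ : Field K) (_ : NumberField K),
        IsImaginaryQuadratic K ∧ 4 < (NumberField.discr K).natAbs ∧
        SatisfiesHeegnerHypothesis ((⟨0, 0, (p : ℚ), 0, 0⟩ : WeierstrassCurve ℚ).conductorNorm ℤ) K ∧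
        ((⟨0, 0, (p : ℚ), 0, 0⟩ : WeierstrassCurve ℚ).quadraticTwist (NumberField.discr K : ℚ)).entireLFunction 1 ≠ 0 ∧
        NumberField.classNumber K < p ∧ ¬ p ∣ NumberField.classNumber K := by
  intro p hp hp72 hnr
  haveI := isElliptic_sylvester hp.ne_zero
  exact cruxConclusion_sqrtMinusTwo hDescU hBT hp hp72 hnr

end Corner

/-! ## §3 The crux body on the family and the infinite-family corollary -/

section Family

/-- ★★ **THE CRUX BODY ON `W := W_n`** for every prime `n ≡ 17, 35 (mod 72)` with `X³ − 3X − 10` irreducible mod `n` (shape of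
`heegnerTwistCouplingInSupply_sylvester`, the bound `n < 10⁵` replaced by the cubic condition): for every prime `p` and all the crux's
hypotheses on `(W_n, p)` (only `¬ Good` and `5 ≤ p` are used: `p = n`), a Heegner `K′` of `N(W_n)` with `4 < |d_{K′}|`, `L(W_n^{(d_{K′})}, 1) ≠ 0`,
`p ∤ h(K′)` — MODULO `hDescU` and Burungale–Tian ONLY. [cite: CohenPazuki2009, §2] [cite: BurungaleTian2026, Thm. 1.1] -/
theorem heegnerTwistCouplingInSupply_sylvester_sqrtMinusTwo
    (hDescU : ∀ (p : ℕ) (K : Type) [Field K] [NumberField K], p.Prime → p % 9 = 8 →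
      IsImaginaryQuadratic K → 4 < (NumberField.discr K).natAbs →
      jacobiSym (NumberField.discr K) 3 = 1 → jacobiSym (NumberField.discr K) p = 1 →
      ¬ 3 ∣ NumberField.classNumber K →
      (∀ (L : Type) [Field L] [NumberField L], Module.finrank ℚ L = 2 →
        NumberField.discr L = -3 * NumberField.discr K →
        ∃ u : (𝓞 L)ˣ, ∀ x : 𝓞 L, (u : 𝓞 L) - x ^ 3 ∉ Ideal.span {(p : 𝓞 L)}) →
      ((⟨0, 0, (p : ℚ), 0, 0⟩ : WeierstrassCurve ℚ).quadraticTwist (NumberField.discr K : ℚ)).mordellWeilRank = 0 ∧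
      ∀ c ∈ ((⟨0, 0, (p : ℚ), 0, 0⟩ : WeierstrassCurve ℚ).quadraticTwist (NumberField.discr K : ℚ)).sha,
        3 • c = 0 → c = 0)
    (hBT : burungaleTian_analyticRank_eq_zero_of_selmerCorank_eq_zero_of_hasCM) {n : ℕ} (hn : n.Prime)
    (hn72 : n % 72 = 17 ∨ n % 72 = 35) (hnr : ∀ x : ZMod n, x ^ 3 - 3 * x - 10 ≠ 0) :
    ∀ (p : ℕ) [Fact p.Prime] [(⟨0, 0, (n : ℚ), 0, 0⟩ : WeierstrassCurve ℚ).IsElliptic]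
      [(⟨0, 0, (n : ℚ), 0, 0⟩ : WeierstrassCurve ℚ).IsGloballyMinimal]
      [NeZero ((⟨0, 0, (n : ℚ), 0, 0⟩ : WeierstrassCurve ℚ).conductorNorm ℤ)],
      (⟨0, 0, (n : ℚ), 0, 0⟩ : WeierstrassCurve ℚ).HasCM → (⟨0, 0, (n : ℚ), 0, 0⟩ : WeierstrassCurve ℚ).analyticRank = 1 → 5 ≤ p →
      CMInert (⟨0, 0, (n : ℚ), 0, 0⟩ : WeierstrassCurve ℚ) p → ¬ Good (⟨0, 0, (n : ℚ), 0, 0⟩ : WeierstrassCurve ℚ) p →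
      (∀ B : ℕ, ∃ (K : Type) (_ : Field K) (_ : NumberField K), IsImaginaryQuadratic K ∧ B < (NumberField.discr K).natAbs ∧
        4 < (NumberField.discr K).natAbs ∧
        SatisfiesHeegnerHypothesis ((⟨0, 0, (n : ℚ), 0, 0⟩ : WeierstrassCurve ℚ).conductorNorm ℤ) K ∧
        ¬ p ∣ NumberField.classNumber K) →
      ∃ (K : Type) (_ : Field K) (_ : NumberField K),
        IsImaginaryQuadratic K ∧ 4 < (NumberField.discr K).natAbs ∧
        SatisfiesHeegnerHypothesis ((⟨0, 0, (n : ℚ), 0, 0⟩ : WeierstrassCurve ℚ).conductorNorm ℤ) K ∧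
        ((⟨0, 0, (n : ℚ), 0, 0⟩ : WeierstrassCurve ℚ).quadraticTwist (NumberField.discr K : ℚ)).entireLFunction 1 ≠ 0 ∧
        ¬ p ∣ NumberField.classNumber K := by
  intro p _ _ _ _ _ _ h5 _ hbad _
  obtain rfl := eq_of_not_good_sylvester hn h5 hbad
  obtain ⟨K, iF, iN, hK, h4, hH, hL, -, hndvd⟩ := cruxConclusion_sqrtMinusTwo hDescU hBT hn hn72 hnr
  exact ⟨K, iF, iN, hK, h4, hH, hL, hndvd⟩

/-- **The infinite family, modulo its Chebotarev instance.** If infinitely many primes `p ≡ 17, 35 (mod 72)` have `X³ − 3X − 10` irreducible mod `p`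
(Chebotarev for `ℚ(ζ₇₂, √−2, θ)`, `θ³ = 3θ + 10`, density `2/3` inside the progression — NOT in the tree, hypothesis `hInf`), then at infinitely
many primes `p` the conclusion of crux 21381 holds for `(W_p, p)` — MODULO `hDescU`, `hBT`, `hInf` (no `hCube`, no digit, no class number).
Shape of `FrobeniusFan.infinite_corner_of_infinite_digit`. [cite: CohenPazuki2009, §2] [cite: BurungaleTian2026, Thm. 1.1] -/
theorem infinite_corner_of_infinite_noRoot
    (hDescU : ∀ (p : ℕ) (K : Type) [Field K] [NumberField K], p.Prime → p % 9 = 8 →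
      IsImaginaryQuadratic K → 4 < (NumberField.discr K).natAbs →
      jacobiSym (NumberField.discr K) 3 = 1 → jacobiSym (NumberField.discr K) p = 1 →
      ¬ 3 ∣ NumberField.classNumber K →
      (∀ (L : Type) [Field L] [NumberField L], Module.finrank ℚ L = 2 →
        NumberField.discr L = -3 * NumberField.discr K →
        ∃ u : (𝓞 L)ˣ, ∀ x : 𝓞 L, (u : 𝓞 L) - x ^ 3 ∉ Ideal.span {(p : 𝓞 L)}) →
      ((⟨0, 0, (p : ℚ), 0, 0⟩ : WeierstrassCurve ℚ).quadraticTwist (NumberField.discr K : ℚ)).mordellWeilRank = 0 ∧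
      ∀ c ∈ ((⟨0, 0, (p : ℚ), 0, 0⟩ : WeierstrassCurve ℚ).quadraticTwist (NumberField.discr K : ℚ)).sha,
        3 • c = 0 → c = 0)
    (hBT : burungaleTian_analyticRank_eq_zero_of_selmerCorank_eq_zero_of_hasCM)
    (hInf : Set.Infinite {p : ℕ | p.Prime ∧ (p % 72 = 17 ∨ p % 72 = 35) ∧ ∀ x : ZMod p, x ^ 3 - 3 * x - 10 ≠ 0}) :
    Set.Infinite {p : ℕ | ∃ hp : p.Prime, p % 9 = 8 ∧
      haveI := isElliptic_sylvester hp.ne_zero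
      ∃ (K : Type) (_ : Field K) (_ : NumberField K),
        IsImaginaryQuadratic K ∧ 4 < (NumberField.discr K).natAbs ∧
        SatisfiesHeegnerHypothesis ((⟨0, 0, (p : ℚ), 0, 0⟩ : WeierstrassCurve ℚ).conductorNorm ℤ) K ∧
        ((⟨0, 0, (p : ℚ), 0, 0⟩ : WeierstrassCurve ℚ).quadraticTwist (NumberField.discr K : ℚ)).entireLFunction 1 ≠ 0 ∧
        NumberField.classNumber K < p ∧ ¬ p ∣ NumberField.classNumber K} := by
  refine hInf.mono fun p hp' ↦ ?_
  obtain ⟨hp, hp72, hnr⟩ := hp'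
  exact ⟨hp, ((mod_seventyTwo_iff p).mp hp72).1, cruxOnSylvesterCorner_sqrtMinusTwo hDescU hBT p hp hp72 hnr⟩

end Family

/-! ## §4 Kernel instances: the digit-zero primes `17`, `107`; the uncertified prime `89` -/

section Instances

/-- `X³ − 3X − 10` has no root mod `17` (`17 = 3² + 2·2²`, `9 ∤ 3`). [folklore] -/
theorem noRoot_17 : ∀ x : ZMod 17, x ^ 3 - 3 * x - 10 ≠ 0 := by decide

/-- `X³ − 3X − 10` has no root mod `107` (`107 = 3² + 2·7²`, `9 ∤ 3`). [folklore] -/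
theorem noRoot_107 : ∀ x : ZMod 107, x ^ 3 - 3 * x - 10 ≠ 0 := by decide

/-- `X³ − 3X − 10 ≡ (X − 46)(X − 52)(X − 80) (mod 89)` has the root `46` (`89 = 9² + 2·2²`, `9 ∣ 9`). [folklore] -/
theorem root_89 : (46 : ZMod 89) ^ 3 - 3 * 46 - 10 = 0 := by decide

/-- ★ **`p = 17`** (digit-ZERO prime of w4 g30's fan, `17 ≡ 17 (mod 72)`): the conclusion of crux 21381 at `(W_17, 17)` with `K′ = ℚ(√−2)`,
modulo `hDescU` and Burungale–Tian only. [cite: CohenPazuki2009, §2] [cite: BurungaleTian2026, Thm. 1.1] -/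
theorem cruxOnSylvesterCorner_sqrtMinusTwo_17
    (hDescU : ∀ (p : ℕ) (K : Type) [Field K] [NumberField K], p.Prime → p % 9 = 8 →
      IsImaginaryQuadratic K → 4 < (NumberField.discr K).natAbs →
      jacobiSym (NumberField.discr K) 3 = 1 → jacobiSym (NumberField.discr K) p = 1 →
      ¬ 3 ∣ NumberField.classNumber K →
      (∀ (L : Type) [Field L] [NumberField L], Module.finrank ℚ L = 2 →
        NumberField.discr L = -3 * NumberField.discr K →
        ∃ u : (𝓞 L)ˣ, ∀ x : 𝓞 L, (u : 𝓞 L) - x ^ 3 ∉ Ideal.span {(p : 𝓞 L)}) →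
      ((⟨0, 0, (p : ℚ), 0, 0⟩ : WeierstrassCurve ℚ).quadraticTwist (NumberField.discr K : ℚ)).mordellWeilRank = 0 ∧
      ∀ c ∈ ((⟨0, 0, (p : ℚ), 0, 0⟩ : WeierstrassCurve ℚ).quadraticTwist (NumberField.discr K : ℚ)).sha,
        3 • c = 0 → c = 0)
    (hBT : burungaleTian_analyticRank_eq_zero_of_selmerCorank_eq_zero_of_hasCM) :
    haveI := isElliptic_sylvester (show (17 : ℕ) ≠ 0 by norm_num)
    ∃ (K : Type) (_ : Field K) (_ : NumberField K),
      IsImaginaryQuadratic K ∧ 4 < (NumberField.discr K).natAbs ∧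
      SatisfiesHeegnerHypothesis ((⟨0, 0, ((17 : ℕ) : ℚ), 0, 0⟩ : WeierstrassCurve ℚ).conductorNorm ℤ) K ∧
      ((⟨0, 0, ((17 : ℕ) : ℚ), 0, 0⟩ : WeierstrassCurve ℚ).quadraticTwist (NumberField.discr K : ℚ)).entireLFunction 1 ≠ 0 ∧
      NumberField.classNumber K < 17 ∧ ¬ 17 ∣ NumberField.classNumber K :=
  cruxOnSylvesterCorner_sqrtMinusTwo hDescU hBT 17 (by norm_num) (by norm_num) noRoot_17

/-- ★ **`p = 107`** (digit-ZERO prime of w4 g30's fan, `107 ≡ 35 (mod 72)`): the conclusion of crux 21381 at `(W_107, 107)` with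
`K′ = ℚ(√−2)`, modulo `hDescU` and Burungale–Tian only. [cite: CohenPazuki2009, §2] [cite: BurungaleTian2026, Thm. 1.1] -/
theorem cruxOnSylvesterCorner_sqrtMinusTwo_107
    (hDescU : ∀ (p : ℕ) (K : Type) [Field K] [NumberField K], p.Prime → p % 9 = 8 →
      IsImaginaryQuadratic K → 4 < (NumberField.discr K).natAbs →
      jacobiSym (NumberField.discr K) 3 = 1 → jacobiSym (NumberField.discr K) p = 1 →
      ¬ 3 ∣ NumberField.classNumber K →
      (∀ (L : Type) [Field L] [NumberField L], Module.finrank ℚ L = 2 →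
        NumberField.discr L = -3 * NumberField.discr K →
        ∃ u : (𝓞 L)ˣ, ∀ x : 𝓞 L, (u : 𝓞 L) - x ^ 3 ∉ Ideal.span {(p : 𝓞 L)}) →
      ((⟨0, 0, (p : ℚ), 0, 0⟩ : WeierstrassCurve ℚ).quadraticTwist (NumberField.discr K : ℚ)).mordellWeilRank = 0 ∧
      ∀ c ∈ ((⟨0, 0, (p : ℚ), 0, 0⟩ : WeierstrassCurve ℚ).quadraticTwist (NumberField.discr K : ℚ)).sha,
        3 • c = 0 → c = 0)
    (hBT : burungaleTian_analyticRank_eq_zero_of_selmerCorank_eq_zero_of_hasCM) :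
    haveI := isElliptic_sylvester (show (107 : ℕ) ≠ 0 by norm_num)
    ∃ (K : Type) (_ : Field K) (_ : NumberField K),
      IsImaginaryQuadratic K ∧ 4 < (NumberField.discr K).natAbs ∧
      SatisfiesHeegnerHypothesis ((⟨0, 0, ((107 : ℕ) : ℚ), 0, 0⟩ : WeierstrassCurve ℚ).conductorNorm ℤ) K ∧
      ((⟨0, 0, ((107 : ℕ) : ℚ), 0, 0⟩ : WeierstrassCurve ℚ).quadraticTwist (NumberField.discr K : ℚ)).entireLFunction 1 ≠ 0 ∧
      NumberField.classNumber K < 107 ∧ ¬ 107 ∣ NumberField.classNumber K :=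
  cruxOnSylvesterCorner_sqrtMinusTwo hDescU hBT 107 (by norm_num) (by norm_num) noRoot_107

/-- At `p = 89 ≡ 17 (mod 72)` the field `ℚ(√−2)` certifies nothing: the cubic has a root, so `89 ∣ Im((10 + 2√24)^{30})` (cubic bridge) — the
unit `5 + 2√6` IS a cube modulo `89`. [cite: IrelandRosen1990, §9.1] -/
theorem not_lucas_89 : (89 : ℤ) ∣ ((⟨10, 2⟩ : ℤ√24) ^ ((89 + 1) / 3)).im :=
  dvd_im_of_root_cubic (p := 89) (by norm_num) (by norm_num) (by norm_num)
    (by rw [show (24 : ℤ) = -3 * -8 by norm_num, jacobiSym.mul_left, jacobiSym_neg_three_eq_neg_one (by decide) (by norm_num),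
      jacobiSym_neg_eight_eq_one (by norm_num)]; norm_num) (by norm_num)
    (x := 46) (by push_cast; decide)

end Instances

/-! ## §5 (append, w4 g31) The whole menu in cubic form: eleven progression families at once -/

section Menu

/-- ★★ **THE ELEVEN CUBIC FAMILIES.** For every row `(D, h, M, a, b)` of the certificate menu of `…SylvesterCornerTable` (`D ∈ {−8, −11, −20,
−35, −47, −56, −68, −71, −95, −119, −155}`, `h = h(D)`, `M = −3D`, `a² − M b² = 4`) and every prime `p ≡ 8 (mod 9)` with `(D/p) = +1`, `h < p`
and `X³ − 3X − a` irreducible mod `p` (no root in `𝔽_p`): the conclusion of crux 21381 at `(W_p, p)` with `K′ = ℚ(√D)`, MODULO `hDescU` and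
Burungale–Tian ONLY — the row `D = −8` is `cruxConclusion_sqrtMinusTwo`; e.g. `D = −11`: `p ≡ 8 (9)`, `(p/11) = +1`, `X³ − 3X − 46`
irreducible. (Numerically the eleven families certify 373 of the 375 primes `p ≡ 8 (mod 9)` below `2·10⁴`; `16001`, `19853` need the rows
`|D| > 155` of `…SylvesterCornerTableII`.) [cite: CohenPazuki2009, §2] [cite: BurungaleTian2026, Thm. 1.1] [cite: IrelandRosen1990, §9.1]
[cite: Cox2013, §2.A Thm. 2.13] -/
theorem cruxConclusion_of_menu_noRoot
    (hDescU : ∀ (p : ℕ) (K : Type) [Field K] [NumberField K], p.Prime → p % 9 = 8 →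
      IsImaginaryQuadratic K → 4 < (NumberField.discr K).natAbs →
      jacobiSym (NumberField.discr K) 3 = 1 → jacobiSym (NumberField.discr K) p = 1 →
      ¬ 3 ∣ NumberField.classNumber K →
      (∀ (L : Type) [Field L] [NumberField L], Module.finrank ℚ L = 2 →
        NumberField.discr L = -3 * NumberField.discr K →
        ∃ u : (𝓞 L)ˣ, ∀ x : 𝓞 L, (u : 𝓞 L) - x ^ 3 ∉ Ideal.span {(p : 𝓞 L)}) →
      ((⟨0, 0, (p : ℚ), 0, 0⟩ : WeierstrassCurve ℚ).quadraticTwist (NumberField.discr K : ℚ)).mordellWeilRank = 0 ∧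
      ∀ c ∈ ((⟨0, 0, (p : ℚ), 0, 0⟩ : WeierstrassCurve ℚ).quadraticTwist (NumberField.discr K : ℚ)).sha,
        3 • c = 0 → c = 0)
    (hBT : burungaleTian_analyticRank_eq_zero_of_selmerCorank_eq_zero_of_hasCM)
    {p : ℕ} (hp : p.Prime) (hp9 : p % 9 = 8) [(⟨0, 0, (p : ℚ), 0, 0⟩ : WeierstrassCurve ℚ).IsElliptic] :
    ∀ e ∈ [((-8 : ℤ), (1 : ℕ), (24 : ℤ), (10 : ℤ), (2 : ℤ)), (-11, 1, 33, 46, 8), (-20, 2, 60, 8, 1),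
      (-35, 2, 105, 82, 8), (-47, 5, 141, 190, 16), (-56, 4, 168, 26, 2), (-68, 4, 204, 100, 7), (-71, 7, 213, 73, 5),
      (-95, 8, 285, 17, 1), (-119, 10, 357, 19, 1), (-155, 4, 465, 31742, 1472)],
      jacobiSym e.1 p = 1 → e.2.1 < p → (∀ x : ZMod p, x ^ 3 - 3 * x - (e.2.2.2.1 : ZMod p) ≠ 0) →
      ∃ (K : Type) (_ : Field K) (_ : NumberField K),
        IsImaginaryQuadratic K ∧ 4 < (NumberField.discr K).natAbs ∧
        SatisfiesHeegnerHypothesis ((⟨0, 0, (p : ℚ), 0, 0⟩ : WeierstrassCurve ℚ).conductorNorm ℤ) K ∧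
        ((⟨0, 0, (p : ℚ), 0, 0⟩ : WeierstrassCurve ℚ).quadraticTwist (NumberField.discr K : ℚ)).entireLFunction 1 ≠ 0 ∧
        NumberField.classNumber K < p ∧ ¬ p ∣ NumberField.classNumber K := by
  intro e he hJp hh hnr
  obtain ⟨-, hD4, hD3, hM, hab, hh3⟩ := menu_spec e he
  have hJ3 : jacobiSym e.1 3 = 1 := jacobiSym_eq_one_of_euler Nat.prime_three (by norm_num) hD3
  rw [hM] at hab
  exact exists_cruxConclusion_of_noRoot_BT hDescU hBT hp hp9 (menu_fields e he) hD4 hJ3 hJp hh hh3 hab hnr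

/-- `X³ − 3X − 8` has no root mod `89` (row `D = −20`, unit `4 + √15 = (8 + √60)/2`). [folklore] -/
theorem noRoot_89_row20 : ∀ x : ZMod 89, x ^ 3 - 3 * x - 8 ≠ 0 := by decide

/-- ★ **`p = 89` through the row `D = −20`** (`h(−20) = 2`, `(−20/89) = +1`): where `ℚ(√−2)` certifies nothing (`not_lucas_89`), `ℚ(√−5)` does —
the conclusion of crux 21381 at `(W_89, 89)`, modulo `hDescU` and Burungale–Tian only. [cite: CohenPazuki2009, §2] [cite: BurungaleTian2026, Thm. 1.1] -/
theorem cruxOnSylvesterCorner_89_row20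
    (hDescU : ∀ (p : ℕ) (K : Type) [Field K] [NumberField K], p.Prime → p % 9 = 8 →
      IsImaginaryQuadratic K → 4 < (NumberField.discr K).natAbs →
      jacobiSym (NumberField.discr K) 3 = 1 → jacobiSym (NumberField.discr K) p = 1 →
      ¬ 3 ∣ NumberField.classNumber K →
      (∀ (L : Type) [Field L] [NumberField L], Module.finrank ℚ L = 2 →
        NumberField.discr L = -3 * NumberField.discr K →
        ∃ u : (𝓞 L)ˣ, ∀ x : 𝓞 L, (u : 𝓞 L) - x ^ 3 ∉ Ideal.span {(p : 𝓞 L)}) →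
      ((⟨0, 0, (p : ℚ), 0, 0⟩ : WeierstrassCurve ℚ).quadraticTwist (NumberField.discr K : ℚ)).mordellWeilRank = 0 ∧
      ∀ c ∈ ((⟨0, 0, (p : ℚ), 0, 0⟩ : WeierstrassCurve ℚ).quadraticTwist (NumberField.discr K : ℚ)).sha,
        3 • c = 0 → c = 0)
    (hBT : burungaleTian_analyticRank_eq_zero_of_selmerCorank_eq_zero_of_hasCM) :
    haveI := isElliptic_sylvester (show (89 : ℕ) ≠ 0 by norm_num)
    ∃ (K : Type) (_ : Field K) (_ : NumberField K),
      IsImaginaryQuadratic K ∧ 4 < (NumberField.discr K).natAbs ∧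
      SatisfiesHeegnerHypothesis ((⟨0, 0, ((89 : ℕ) : ℚ), 0, 0⟩ : WeierstrassCurve ℚ).conductorNorm ℤ) K ∧
      ((⟨0, 0, ((89 : ℕ) : ℚ), 0, 0⟩ : WeierstrassCurve ℚ).quadraticTwist (NumberField.discr K : ℚ)).entireLFunction 1 ≠ 0 ∧
      NumberField.classNumber K < 89 ∧ ¬ 89 ∣ NumberField.classNumber K := by
  haveI := isElliptic_sylvester (show (89 : ℕ) ≠ 0 by norm_num)
  have hJ : jacobiSym (-20) 89 = 1 :=
    jacobiSym_eq_one_of_euler (D := -20) (by norm_num) (by norm_num) (by decide +kernel)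
  exact cruxConclusion_of_menu_noRoot hDescU hBT (by norm_num) (by norm_num) (-20, 2, 60, 8, 1) (by simp) hJ (by norm_num)
    (fun x => by push_cast; exact noRoot_89_row20 x)

end Menu

end Summit.BirchSwinnertonDyer.BirchSwinnertonDyer.Theorems.SylvesterCorner
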